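import Mathlib
import Summits.NavierStokesRegularity.NavierStokesRegularity.Theorems.EulerZoomLiouvillePowerGaugeEulerLiouvilleQVorticityLimits
import HarnessLib

/-!
# The `q`-power of the vorticity along classical Euler flows with a moving weight — the identity at `ε = 0`
# (helper of the DSS vorticity-decay stratum of the crux `EulerZoomLiouville.PowerGaugeEulerLiouville`,
# route №10, item stmt-NavierStokesRegularity-19832)

Helper file (theorems only; `--supports stmt-NavierStokesRegularity-19832`). Seat ns-typeII-p3 (cell
ns-regularity-ideate §B, D-0081). Sequel of `…QVorticityTools.lean` / `…QVorticityLimits.lean`: dominated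
convergence `ε = 1/(j+1) → 0` in the cut-off identity `integral_cutoff_weight_qpow_sub_eq` on the space-time
slab gives, for a classical Euler flow on `[0, T]` with bounded `u, ∇u`, a jointly smooth weight `Θ`
with `|Θ| ≤ 1` and bounded `∂ₜΘ, DΘ`, every `q > 0` and `R > 0` (`integral_cutoff_weight_rpow_sub_eq`):
`½∫χ_R Θ(T)²|ω(T)|^q − ½∫χ_R Θ(0)²|ω(0)|^q
   = ∫₀ᵀ (½∫Dχ_R[u]Θ²|ω|^q + ∫χ_R[(q/2)Θ²|ω|^q⟪ξ, Du ξ⟫ + Θ|ω|^q(∂ₜΘ + DΘ[u])]) dσ`, `ξ = ω/|ω|`.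

WHAT THIS IS NOT: not NS, not the crux — a calculus identity for classical Euler flows. [folklore]
-/

noncomputable section

-- the summit and its single problem share the name `NavierStokesRegularity` (D-0017 nested layout)
set_option linter.dupNamespace false

open Set Function Filter Topology MeasureTheory Metric
open scoped NNReal ENNReal InnerProductSpace RealInnerProductSpace

namespace Summit.NavierStokesRegularity.NavierStokesRegularity.Theorems.PowerGaugeEulerLiouville.VorticityDecay

open Literature.Analysis Literature.Analysis.FluidPDE
open Summit.NavierStokesRegularity.NavierStokesRegularity.Theorems.PowerGaugeEulerLiouville.VorticitySupport

/-- Products `χ_R · g` with the cut-off have compact support (`R > 0`). [folklore] -/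
theorem hasCompactSupport_cutoff_mul {R : ℝ} (hR : 0 < R) (g : (EuclideanSpace ℝ (Fin 3)) → ℝ) :
    HasCompactSupport (fun x => cutoff R x * g x) :=
  (hasCompactSupport_cutoff hR).mul_right (f' := g)

section Eps

variable {T : ℝ} {v : ℝ → (EuclideanSpace ℝ (Fin 3)) → (EuclideanSpace ℝ (Fin 3))}
  {p : ℝ → (EuclideanSpace ℝ (Fin 3)) → ℝ} {Θ : ℝ → (EuclideanSpace ℝ (Fin 3)) → ℝ}

/-- **The cut-off identity for the weighted `q`-power of the vorticity (`ε = 0`).** For a classical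
Euler flow on `[0, T]` (`T > 0`) with `‖u‖, ‖∇u‖ ≤ B` on `[0, T]`, a jointly smooth weight `Θ` with
`|Θ| ≤ 1`, `|∂ₜΘ|, ‖DΘ‖ ≤ M` on `[0, T]`, `q > 0` and `R > 0`:
`½∫χ_R Θ(T)²|ω(T)|^q − ½∫χ_R Θ(0)²|ω(0)|^q = ∫_{σ∈(0,T)} (½∫ Dχ_R[u(σ)] Θ²|ω|^q
  + ∫ χ_R [(q/2) Θ² |ω|^q ⟪ξ, Du ξ⟫ + Θ |ω|^q (∂ₜΘ + DΘ[u])]) dσ`, `ξ = ω/|ω|`. [folklore] -/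
theorem integral_cutoff_weight_rpow_sub_eq (hT : 0 < T) (hv : IsClassicalNSSolutionOn (Icc 0 T) 0 0 v p)
    {B : ℝ} (hB : ∀ σ ∈ Icc 0 T, ∀ y, ‖v σ y‖ ≤ B ∧ ‖fderiv ℝ (v σ) y‖ ≤ B)
    (hΘ : IsSmoothSpaceTimeOn (Icc 0 T) Θ) {M : ℝ}
    (hΘM : ∀ σ ∈ Icc 0 T, ∀ y, |Θ σ y| ≤ 1 ∧
      |FluidPDE.timeDerivWithin (Icc 0 T) Θ σ y| ≤ M ∧ ‖fderiv ℝ (Θ σ) y‖ ≤ M)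
    {q : ℝ} (hq : 0 < q) {R : ℝ} (hR : 0 < R) :
    2⁻¹ * (∫ x, cutoff R x * (Θ T x ^ 2 * ‖curl (v T) x‖ ^ q)) -
      2⁻¹ * (∫ x, cutoff R x * (Θ 0 x ^ 2 * ‖curl (v 0) x‖ ^ q)) =
      ∫ σ in Ioo 0 T, (2⁻¹ * (∫ x, fderiv ℝ (cutoff R) x (v σ x) * (Θ σ x ^ 2 * ‖curl (v σ) x‖ ^ q)) +
        ((∫ x, cutoff R x * (q / 2 * Θ σ x ^ 2) * (‖curl (v σ) x‖ ^ q *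
            ⟪‖curl (v σ) x‖⁻¹ • curl (v σ) x, fderiv ℝ (v σ) x (‖curl (v σ) x‖⁻¹ • curl (v σ) x)⟫)) +
          ∫ x, cutoff R x * (Θ σ x *
              (FluidPDE.timeDerivWithin (Icc 0 T) Θ σ x + fderiv ℝ (Θ σ) x (v σ x))) *
            ‖curl (v σ) x‖ ^ q)) := by
  have hS : UniqueDiffOn ℝ (Icc 0 T) := uniqueDiffOn_Icc hT
  have hTm : T ∈ Icc 0 T := ⟨hT.le, le_rfl⟩
  have h0m : (0 : ℝ) ∈ Icc 0 T := ⟨le_rfl, hT.le⟩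
  have h2R : (0 : ℝ) < 2 * R := by linarith
  obtain ⟨C, hC0, hC⟩ := exists_norm_fderiv_cutoff_le (E := (EuclideanSpace ℝ (Fin 3)))
  have hχ1 : ContDiff ℝ 1 (cutoff (E := (EuclideanSpace ℝ (Fin 3))) R) := contDiff_cutoff R
  have hχ : Continuous (cutoff (E := (EuclideanSpace ℝ (Fin 3))) R) := hχ1.continuous
  have hχc : HasCompactSupport (cutoff (E := (EuclideanSpace ℝ (Fin 3))) R) := hasCompactSupport_cutoff hR
  have hχ2 : Continuous (cutoff (E := (EuclideanSpace ℝ (Fin 3))) (2 * R)) :=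
    (contDiff_cutoff (n := 0) (2 * R)).continuous
  have hχ2c : HasCompactSupport (cutoff (E := (EuclideanSpace ℝ (Fin 3))) (2 * R)) :=
    hasCompactSupport_cutoff h2R
  have hB0 : 0 ≤ B := (norm_nonneg _).trans (hB 0 h0m 0).1
  have hM0 : 0 ≤ M := (norm_nonneg _).trans (hΘM 0 h0m 0).2.2
  -- continuity data (slices)
  have hvc : ∀ σ ∈ Icc 0 T, Continuous (v σ) := fun σ hσ => (hv.contDiff_velocity hσ).continuous
  have hωc : ∀ σ ∈ Icc 0 T, Continuous (curl (v σ)) := fun σ hσ =>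
    (contDiff_curl (n := 0) ((hv.contDiff_velocity hσ).of_le (by norm_cast))).continuous
  have hAc : ∀ σ ∈ Icc 0 T, Continuous (fun x => fderiv ℝ (v σ) x) := fun σ hσ =>
    (hv.contDiff_velocity hσ).continuous_fderiv (by simp)
  have hΘc : ∀ σ ∈ Icc 0 T, Continuous (Θ σ) := fun σ hσ => (hΘ.contDiff_slice hσ).continuous
  have hmc : ∀ σ ∈ Icc 0 T, Continuous (fun x =>
      FluidPDE.timeDerivWithin (Icc 0 T) Θ σ x + fderiv ℝ (Θ σ) x (v σ x)) := fun σ hσ =>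
    ((hΘ.timeDerivWithin hS).contDiff_slice hσ).continuous.add
      (((hΘ.contDiff_slice hσ).continuous_fderiv (by simp)).clm_apply (hvc σ hσ))
  have hDχc : ∀ σ ∈ Icc 0 T, Continuous (fun x => fderiv ℝ (cutoff R) x (v σ x)) := fun σ hσ =>
    (hχ1.continuous_fderiv one_ne_zero).clm_apply (hvc σ hσ)
  -- the flux weight rewritten with the cut-off `χ_{2R}` (the gradient of `χ_R` lives in `B̄(0,2R)`)
  have hflux_eq : ∀ σ (g : (EuclideanSpace ℝ (Fin 3)) → ℝ),
      (∫ x, fderiv ℝ (cutoff R) x (v σ x) * g x) =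
        ∫ x, cutoff (2 * R) x * fderiv ℝ (cutoff R) x (v σ x) * g x := by
    intro σ g
    refine integral_congr_ae (Eventually.of_forall fun x => ?_)
    beta_reduce
    by_cases hx : x ∈ closedBall (0 : (EuclideanSpace ℝ (Fin 3))) (2 * R)
    · rw [cutoff_eq_one h2R (mem_closedBall_zero_iff.1 hx), one_mul]
    · simp [fderiv_cutoff_eq_zero hR hx]
  -- the identity at level `j`
  have hid := fun j : ℕ => integral_cutoff_weight_qpow_sub_eq hT hv hΘ (fun σ hσ => ⟨B, hB σ hσ⟩)
    (ε := ((j : ℝ) + 1)⁻¹) (by positivity) q hR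
  -- abbreviations for the three `j`-dependent slice integrals and their limits
  set G : ℕ → ℝ → ℝ := fun j σ => (2⁻¹ * (∫ x, fderiv ℝ (cutoff R) x (v σ x) *
      (Θ σ x ^ 2 * (‖curl (v σ) x‖ ^ 2 + ((j : ℝ) + 1)⁻¹) ^ (q / 2))) +
    ∫ x, cutoff R x *
      (q / 2 * Θ σ x ^ 2 * (‖curl (v σ) x‖ ^ 2 + ((j : ℝ) + 1)⁻¹) ^ (q / 2 - 1) *
          ⟪curl (v σ) x, fderiv ℝ (v σ) x (curl (v σ) x)⟫ +
        Θ σ x * (‖curl (v σ) x‖ ^ 2 + ((j : ℝ) + 1)⁻¹) ^ (q / 2) *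
          (FluidPDE.timeDerivWithin (Icc 0 T) Θ σ x + fderiv ℝ (Θ σ) x (v σ x)))) with hG
  -- pointwise regrouping of the integrands into `weight * power` / `weight * source`
  have hsplit : ∀ (j : ℕ) σ x, cutoff R x *
      (q / 2 * Θ σ x ^ 2 * (‖curl (v σ) x‖ ^ 2 + ((j : ℝ) + 1)⁻¹) ^ (q / 2 - 1) *
          ⟪curl (v σ) x, fderiv ℝ (v σ) x (curl (v σ) x)⟫ +
        Θ σ x * (‖curl (v σ) x‖ ^ 2 + ((j : ℝ) + 1)⁻¹) ^ (q / 2) *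
          (FluidPDE.timeDerivWithin (Icc 0 T) Θ σ x + fderiv ℝ (Θ σ) x (v σ x))) =
      cutoff R x * (q / 2 * Θ σ x ^ 2) * ((‖curl (v σ) x‖ ^ 2 + ((j : ℝ) + 1)⁻¹) ^ (q / 2 - 1) *
          ⟪curl (v σ) x, fderiv ℝ (v σ) x (curl (v σ) x)⟫) +
        cutoff R x * (Θ σ x * (FluidPDE.timeDerivWithin (Icc 0 T) Θ σ x + fderiv ℝ (Θ σ) x (v σ x))) *
          (‖curl (v σ) x‖ ^ 2 + ((j : ℝ) + 1)⁻¹) ^ (q / 2) := fun j σ x => by ring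
  -- the left-hand sides converge
  have hL : Tendsto (fun j : ℕ =>
      2⁻¹ * (∫ x, cutoff R x * (Θ T x ^ 2 * (‖curl (v T) x‖ ^ 2 + ((j : ℝ) + 1)⁻¹) ^ (q / 2))) -
        2⁻¹ * (∫ x, cutoff R x * (Θ 0 x ^ 2 * (‖curl (v 0) x‖ ^ 2 + ((j : ℝ) + 1)⁻¹) ^ (q / 2))))
      atTop (𝓝 (2⁻¹ * (∫ x, cutoff R x * (Θ T x ^ 2 * ‖curl (v T) x‖ ^ q)) -
        2⁻¹ * (∫ x, cutoff R x * (Θ 0 x ^ 2 * ‖curl (v 0) x‖ ^ q)))) := by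
    have h1 : ∀ t ∈ Icc 0 T, Tendsto (fun j : ℕ => ∫ x, cutoff R x *
        (Θ t x ^ 2 * (‖curl (v t) x‖ ^ 2 + ((j : ℝ) + 1)⁻¹) ^ (q / 2))) atTop
        (𝓝 (∫ x, cutoff R x * (Θ t x ^ 2 * ‖curl (v t) x‖ ^ q))) := by
      intro t ht
      have h := tendsto_integral_mul_qpow hq (hωc t ht) (ψ := fun x => cutoff R x * Θ t x ^ 2)
        (hχ.mul ((hΘc t ht).pow 2)) (hasCompactSupport_cutoff_mul hR fun x => Θ t x ^ 2)
      have e1 : (fun j : ℕ => ∫ x, cutoff R x * (Θ t x ^ 2 * (‖curl (v t) x‖ ^ 2 + ((j : ℝ) + 1)⁻¹) ^ (q / 2))) =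
          fun j : ℕ => ∫ x, (cutoff R x * Θ t x ^ 2) * (‖curl (v t) x‖ ^ 2 + ((j : ℝ) + 1)⁻¹) ^ (q / 2) :=
        funext fun j => integral_congr_ae (Eventually.of_forall fun x => by ring)
      have e2 : (∫ x, cutoff R x * (Θ t x ^ 2 * ‖curl (v t) x‖ ^ q)) =
          ∫ x, (cutoff R x * Θ t x ^ 2) * ‖curl (v t) x‖ ^ q :=
        integral_congr_ae (Eventually.of_forall fun x => by ring)
      rw [e1, e2]
      exact h
    exact ((h1 T hTm).const_mul _).sub ((h1 0 h0m).const_mul _)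
  -- pointwise (in `σ`) limit of the right-hand integrands
  have hGlim : ∀ σ ∈ Ioo 0 T, Tendsto (fun j => G j σ) atTop
      (𝓝 ((2⁻¹ * (∫ x, fderiv ℝ (cutoff R) x (v σ x) * (Θ σ x ^ 2 * ‖curl (v σ) x‖ ^ q)) +
        ((∫ x, cutoff R x * (q / 2 * Θ σ x ^ 2) * (‖curl (v σ) x‖ ^ q *
            ⟪‖curl (v σ) x‖⁻¹ • curl (v σ) x, fderiv ℝ (v σ) x (‖curl (v σ) x‖⁻¹ • curl (v σ) x)⟫)) +
          ∫ x, cutoff R x * (Θ σ x *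
              (FluidPDE.timeDerivWithin (Icc 0 T) Θ σ x + fderiv ℝ (Θ σ) x (v σ x))) *
            ‖curl (v σ) x‖ ^ q)))) := by
    intro σ hσ
    have hσ' : σ ∈ Icc 0 T := Ioo_subset_Icc_self hσ
    -- flux piece
    have hf := tendsto_integral_mul_qpow hq (hωc σ hσ')
      (ψ := fun x => cutoff (2 * R) x * (fderiv ℝ (cutoff R) x (v σ x) * Θ σ x ^ 2))
      (hχ2.mul ((hDχc σ hσ').mul ((hΘc σ hσ').pow 2)))
      (hasCompactSupport_cutoff_mul h2R fun x => fderiv ℝ (cutoff R) x (v σ x) * Θ σ x ^ 2)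
    have hf' : Tendsto (fun j : ℕ => ∫ x, fderiv ℝ (cutoff R) x (v σ x) *
        (Θ σ x ^ 2 * (‖curl (v σ) x‖ ^ 2 + ((j : ℝ) + 1)⁻¹) ^ (q / 2))) atTop
        (𝓝 (∫ x, fderiv ℝ (cutoff R) x (v σ x) * (Θ σ x ^ 2 * ‖curl (v σ) x‖ ^ q))) := by
      have e1 : ∀ j : ℕ, (∫ x, fderiv ℝ (cutoff R) x (v σ x) *
          (Θ σ x ^ 2 * (‖curl (v σ) x‖ ^ 2 + ((j : ℝ) + 1)⁻¹) ^ (q / 2))) =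
          ∫ x, (cutoff (2 * R) x * (fderiv ℝ (cutoff R) x (v σ x) * Θ σ x ^ 2)) *
            (‖curl (v σ) x‖ ^ 2 + ((j : ℝ) + 1)⁻¹) ^ (q / 2) := by
        intro j
        rw [hflux_eq σ]
        exact integral_congr_ae (Eventually.of_forall fun x => by simp only; ring)
      have e2 : (∫ x, fderiv ℝ (cutoff R) x (v σ x) * (Θ σ x ^ 2 * ‖curl (v σ) x‖ ^ q)) =
          ∫ x, (cutoff (2 * R) x * (fderiv ℝ (cutoff R) x (v σ x) * Θ σ x ^ 2)) * ‖curl (v σ) x‖ ^ q := by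
        rw [hflux_eq σ]
        exact integral_congr_ae (Eventually.of_forall fun x => by simp only; ring)
      rw [e2, show (fun j : ℕ => ∫ x, fderiv ℝ (cutoff R) x (v σ x) *
          (Θ σ x ^ 2 * (‖curl (v σ) x‖ ^ 2 + ((j : ℝ) + 1)⁻¹) ^ (q / 2))) = _ from funext e1]
      exact hf
    -- source pieces
    have hs1 := tendsto_integral_mul_qsource hq (hωc σ hσ') (hAc σ hσ')
      (ψ := fun x => cutoff R x * (q / 2 * Θ σ x ^ 2))
      (hχ.mul (continuous_const.mul ((hΘc σ hσ').pow 2)))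
      (hasCompactSupport_cutoff_mul hR fun x => q / 2 * Θ σ x ^ 2)
    have hs2 := tendsto_integral_mul_qpow hq (hωc σ hσ')
      (ψ := fun x => cutoff R x * (Θ σ x *
        (FluidPDE.timeDerivWithin (Icc 0 T) Θ σ x + fderiv ℝ (Θ σ) x (v σ x))))
      (hχ.mul ((hΘc σ hσ').mul (hmc σ hσ')))
      (hasCompactSupport_cutoff_mul hR fun x => Θ σ x *
        (FluidPDE.timeDerivWithin (Icc 0 T) Θ σ x + fderiv ℝ (Θ σ) x (v σ x)))
    -- integrability of the two source pieces at every `j` (to split the integral)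
    have hi1 : ∀ j : ℕ, Integrable (fun x => cutoff R x * (q / 2 * Θ σ x ^ 2) *
        ((‖curl (v σ) x‖ ^ 2 + ((j : ℝ) + 1)⁻¹) ^ (q / 2 - 1) *
          ⟪curl (v σ) x, fderiv ℝ (v σ) x (curl (v σ) x)⟫)) := by
      intro j
      have hj : (0 : ℝ) < ((j : ℝ) + 1)⁻¹ := by positivity
      refine Continuous.integrable_of_hasCompactSupport ?_
        ((hasCompactSupport_cutoff_mul hR fun x => q / 2 * Θ σ x ^ 2).mul_right (f' := fun x =>
          (‖curl (v σ) x‖ ^ 2 + ((j : ℝ) + 1)⁻¹) ^ (q / 2 - 1) * ⟪curl (v σ) x, fderiv ℝ (v σ) x (curl (v σ) x)⟫))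
      exact (hχ.mul (continuous_const.mul ((hΘc σ hσ').pow 2))).mul
        ((((hωc σ hσ').norm.pow 2).add continuous_const |>.rpow_const fun x =>
          Or.inl (add_pos_of_nonneg_of_pos (sq_nonneg _) hj).ne').mul
          ((hωc σ hσ').inner ((hAc σ hσ').clm_apply (hωc σ hσ'))))
    have hi2 : ∀ j : ℕ, Integrable (fun x => cutoff R x *
        (Θ σ x * (FluidPDE.timeDerivWithin (Icc 0 T) Θ σ x + fderiv ℝ (Θ σ) x (v σ x))) *
        (‖curl (v σ) x‖ ^ 2 + ((j : ℝ) + 1)⁻¹) ^ (q / 2)) := by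
      intro j
      have hj : (0 : ℝ) < ((j : ℝ) + 1)⁻¹ := by positivity
      refine Continuous.integrable_of_hasCompactSupport ?_
        ((hasCompactSupport_cutoff_mul hR fun x => Θ σ x *
          (FluidPDE.timeDerivWithin (Icc 0 T) Θ σ x + fderiv ℝ (Θ σ) x (v σ x))).mul_right (f' := fun x =>
          (‖curl (v σ) x‖ ^ 2 + ((j : ℝ) + 1)⁻¹) ^ (q / 2)))
      exact (hχ.mul ((hΘc σ hσ').mul (hmc σ hσ'))).mul
        (((hωc σ hσ').norm.pow 2).add continuous_const |>.rpow_const fun x =>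
          Or.inl (add_pos_of_nonneg_of_pos (sq_nonneg _) hj).ne')
    have hsum := (hf'.const_mul (2⁻¹ : ℝ)).add (hs1.add hs2)
    have hGeq : ∀ j : ℕ, G j σ = 2⁻¹ * (∫ x, fderiv ℝ (cutoff R) x (v σ x) *
        (Θ σ x ^ 2 * (‖curl (v σ) x‖ ^ 2 + ((j : ℝ) + 1)⁻¹) ^ (q / 2))) +
        ((∫ x, cutoff R x * (q / 2 * Θ σ x ^ 2) *
          ((‖curl (v σ) x‖ ^ 2 + ((j : ℝ) + 1)⁻¹) ^ (q / 2 - 1) *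
            ⟪curl (v σ) x, fderiv ℝ (v σ) x (curl (v σ) x)⟫)) +
        ∫ x, cutoff R x *
          (Θ σ x * (FluidPDE.timeDerivWithin (Icc 0 T) Θ σ x + fderiv ℝ (Θ σ) x (v σ x))) *
          (‖curl (v σ) x‖ ^ 2 + ((j : ℝ) + 1)⁻¹) ^ (q / 2)) := by
      intro j
      simp only [hG]
      rw [← integral_add (hi1 j) (hi2 j)]
      congr 1
      exact integral_congr_ae (Eventually.of_forall fun x => hsplit j σ x)
    rw [show (fun j => G j σ) = _ from funext hGeq]
    exact hsum
  -- a uniform bound of the vorticity on `[0, T] × B̄(0, 2R)` (compactness)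
  have hcontv : ContinuousOn (fun z : ℝ × (EuclideanSpace ℝ (Fin 3)) => v z.1 z.2) (Icc 0 T ×ˢ univ) :=
    hv.smooth_velocity.continuousOn
  have hcontω : ContinuousOn (fun z : ℝ × (EuclideanSpace ℝ (Fin 3)) => curl (v z.1) z.2) (Icc 0 T ×ˢ univ) := by
    have := (hv.smooth_velocity.isSmoothSpaceTimeOn_vorticity hS).continuousOn
    exact this
  have hcontA : ContinuousOn (fun z : ℝ × (EuclideanSpace ℝ (Fin 3)) => fderiv ℝ (v z.1) z.2) (Icc 0 T ×ˢ univ) :=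
    hv.smooth_velocity.continuousOn_fderiv_slice hS
  have hcontΘ : ContinuousOn (fun z : ℝ × (EuclideanSpace ℝ (Fin 3)) => Θ z.1 z.2) (Icc 0 T ×ˢ univ) :=
    hΘ.continuousOn
  have hcontm : ContinuousOn (fun z : ℝ × (EuclideanSpace ℝ (Fin 3)) =>
      FluidPDE.timeDerivWithin (Icc 0 T) Θ z.1 z.2 + fderiv ℝ (Θ z.1) z.2 (v z.1 z.2)) (Icc 0 T ×ˢ univ) :=
    (hΘ.continuousOn_timeDerivWithin hS).add ((hΘ.continuousOn_fderiv_slice hS).clm_apply hcontv)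
  obtain ⟨Cω, hCω⟩ := (isCompact_Icc.prod (isCompact_closedBall (0 : (EuclideanSpace ℝ (Fin 3))) (2 * R)))
    |>.exists_bound_of_continuousOn (hcontω.mono (prod_mono le_rfl (subset_univ _)))
  set Pmax : ℝ := (Cω ^ 2 + 1) ^ (q / 2) with hPmax
  have hPmax0 : 0 ≤ Pmax := Real.rpow_nonneg (by positivity) _
  have hPj : ∀ j : ℕ, ∀ σ ∈ Icc 0 T, ∀ x ∈ closedBall (0 : (EuclideanSpace ℝ (Fin 3))) (2 * R),
      0 ≤ (‖curl (v σ) x‖ ^ 2 + ((j : ℝ) + 1)⁻¹) ^ (q / 2) ∧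
        (‖curl (v σ) x‖ ^ 2 + ((j : ℝ) + 1)⁻¹) ^ (q / 2) ≤ Pmax := by
    intro j σ hσ x hx
    have hj : (0 : ℝ) < ((j : ℝ) + 1)⁻¹ := by positivity
    have hj1 : ((j : ℝ) + 1)⁻¹ ≤ 1 := inv_le_one_of_one_le₀ (by linarith [j.cast_nonneg (α := ℝ)])
    have hω := hCω (σ, x) ⟨hσ, hx⟩
    simp only at hω
    refine ⟨Real.rpow_nonneg (by positivity) _, (qpow_le_qpow_one hj hj1 (by positivity) _).trans ?_⟩
    rw [hPmax]
    refine Real.rpow_le_rpow (by positivity) ?_ (by positivity)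
    have := norm_nonneg (curl (v σ) x)
    nlinarith
  -- uniform bound of the right-hand integrands
  set K : ℝ := 2⁻¹ * (C / R * B * Pmax * ∫ x, (closedBall (0 : (EuclideanSpace ℝ (Fin 3))) (2 * R)).indicator
      (fun _ => (1 : ℝ)) x) + (∫ x : (EuclideanSpace ℝ (Fin 3)), ‖cutoff R x‖) *
      (q / 2 * B * Pmax + Pmax * (M + M * B)) with hK
  have hind : Integrable (fun x => (closedBall (0 : (EuclideanSpace ℝ (Fin 3))) (2 * R)).indicator
      (fun _ => (1 : ℝ)) x) :=
    (integrable_indicator_iff measurableSet_closedBall).2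
      (integrableOn_const (isCompact_closedBall _ _).measure_lt_top.ne)
  have hGbound : ∀ j : ℕ, ∀ σ ∈ Ioo 0 T, ‖G j σ‖ ≤ K := by
    intro j σ hσ
    have hσ' : σ ∈ Icc 0 T := Ioo_subset_Icc_self hσ
    have hj : (0 : ℝ) < ((j : ℝ) + 1)⁻¹ := by positivity
    rw [hG, Real.norm_eq_abs]
    refine (abs_add_le _ _).trans (add_le_add ?_ ?_)
    · rw [abs_mul, abs_of_pos (by norm_num : (0 : ℝ) < 2⁻¹)]
      gcongr
      refine (abs_integral_le_integral_abs).trans ?_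
      rw [← integral_const_mul]
      refine integral_mono_of_nonneg (Eventually.of_forall fun x => abs_nonneg _) (hind.const_mul _)
        (Eventually.of_forall fun x => ?_)
      beta_reduce
      refine (abs_fderiv_cutoff_mul_le hR (hC R hR) (hB σ hσ' x).1 x _).trans ?_
      by_cases hx : x ∈ closedBall (0 : (EuclideanSpace ℝ (Fin 3))) (2 * R)
      · rw [Set.indicator_of_mem hx, abs_mul, abs_of_nonneg (hPj j σ hσ' x hx).1]
        have hΘ2 : |Θ σ x ^ 2| ≤ 1 := by
          rw [abs_pow]; exact pow_le_one₀ (abs_nonneg _) (hΘM σ hσ' x).1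
        have h1 : |Θ σ x ^ 2| * (‖curl (v σ) x‖ ^ 2 + ((j : ℝ) + 1)⁻¹) ^ (q / 2) ≤ 1 * Pmax :=
          mul_le_mul hΘ2 (hPj j σ hσ' x hx).2 (hPj j σ hσ' x hx).1 zero_le_one
        have hC' : 0 ≤ C / R * B := by positivity
        calc C / R * B * 1 * (|Θ σ x ^ 2| * (‖curl (v σ) x‖ ^ 2 + ((j : ℝ) + 1)⁻¹) ^ (q / 2))
            = (C / R * B) * (|Θ σ x ^ 2| * (‖curl (v σ) x‖ ^ 2 + ((j : ℝ) + 1)⁻¹) ^ (q / 2)) := by ring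
          _ ≤ (C / R * B) * (1 * Pmax) := mul_le_mul_of_nonneg_left h1 hC'
          _ = C / R * B * Pmax * 1 := by ring
      · simp [Set.indicator_of_notMem hx]
    · refine (abs_integral_le_integral_abs).trans ?_
      rw [← integral_mul_const]
      refine integral_mono_of_nonneg (Eventually.of_forall fun x => abs_nonneg _)
        ((hχ.integrable_of_hasCompactSupport hχc).norm.mul_const _) (Eventually.of_forall fun x => ?_)
      beta_reduce
      rw [abs_mul, ← Real.norm_eq_abs (cutoff R x)]
      by_cases hx0 : cutoff R x = 0
      · simp [hx0]
      have hx : x ∈ closedBall (0 : (EuclideanSpace ℝ (Fin 3))) (2 * R) :=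
        tsupport_cutoff_subset hR (subset_tsupport _ (Function.mem_support.2 hx0))
      gcongr
      have hP := hPj j σ hσ' x hx
      have hΘ1 := (hΘM σ hσ' x).1
      have hm : |FluidPDE.timeDerivWithin (Icc 0 T) Θ σ x + fderiv ℝ (Θ σ) x (v σ x)| ≤ M + M * B := by
        refine (abs_add_le _ _).trans (add_le_add (hΘM σ hσ' x).2.1 ?_)
        rw [← Real.norm_eq_abs]
        exact ((fderiv ℝ (Θ σ) x).le_opNorm _).trans (mul_le_mul (hΘM σ hσ' x).2.2 (hB σ hσ' x).1
          (norm_nonneg _) hM0)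
      have hΘ2 : |Θ σ x ^ 2| ≤ 1 := by rw [abs_pow]; exact pow_le_one₀ (abs_nonneg _) hΘ1
      have hA1 : |q / 2 * Θ σ x ^ 2 * (‖curl (v σ) x‖ ^ 2 + ((j : ℝ) + 1)⁻¹) ^ (q / 2 - 1) *
          ⟪curl (v σ) x, fderiv ℝ (v σ) x (curl (v σ) x)⟫| ≤ q / 2 * B * Pmax := by
        have hs := (abs_qsource_le (a := q / 2) hj (curl (v σ) x) (fderiv ℝ (v σ) x)).trans
          (mul_le_mul (hB σ hσ' x).2 hP.2 hP.1 hB0)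
        have hqΘ : |q / 2 * Θ σ x ^ 2| ≤ q / 2 := by
          rw [abs_mul, abs_of_pos (by positivity : (0 : ℝ) < q / 2)]
          exact mul_le_of_le_one_right (by positivity) hΘ2
        rw [show q / 2 * Θ σ x ^ 2 * (‖curl (v σ) x‖ ^ 2 + ((j : ℝ) + 1)⁻¹) ^ (q / 2 - 1) *
            ⟪curl (v σ) x, fderiv ℝ (v σ) x (curl (v σ) x)⟫ = (q / 2 * Θ σ x ^ 2) *
            ((‖curl (v σ) x‖ ^ 2 + ((j : ℝ) + 1)⁻¹) ^ (q / 2 - 1) *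
              ⟪curl (v σ) x, fderiv ℝ (v σ) x (curl (v σ) x)⟫) by ring, abs_mul]
        calc _ ≤ q / 2 * (B * Pmax) := mul_le_mul hqΘ hs (abs_nonneg _) (by positivity)
          _ = q / 2 * B * Pmax := by ring
      have hA2 : |Θ σ x * (‖curl (v σ) x‖ ^ 2 + ((j : ℝ) + 1)⁻¹) ^ (q / 2) *
          (FluidPDE.timeDerivWithin (Icc 0 T) Θ σ x + fderiv ℝ (Θ σ) x (v σ x))| ≤
          Pmax * (M + M * B) := by
        rw [abs_mul, abs_mul, abs_of_nonneg hP.1]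
        calc |Θ σ x| * (‖curl (v σ) x‖ ^ 2 + ((j : ℝ) + 1)⁻¹) ^ (q / 2) *
              |FluidPDE.timeDerivWithin (Icc 0 T) Θ σ x + fderiv ℝ (Θ σ) x (v σ x)|
            ≤ 1 * Pmax * (M + M * B) :=
              mul_le_mul (mul_le_mul hΘ1 hP.2 hP.1 zero_le_one) hm (abs_nonneg _) (by positivity)
          _ = Pmax * (M + M * B) := by ring
      exact (abs_add_le _ _).trans (add_le_add hA1 hA2)
  -- continuity in `σ` of the right-hand integrands (parametric integrals, compact support)
  have hGcont : ∀ j : ℕ, ContinuousOn (G j) (Icc 0 T) := by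
    intro j
    have hj : (0 : ℝ) < ((j : ℝ) + 1)⁻¹ := by positivity
    have hPc : ∀ a : ℝ, ContinuousOn (fun z : ℝ × (EuclideanSpace ℝ (Fin 3)) =>
        (‖curl (v z.1) z.2‖ ^ 2 + ((j : ℝ) + 1)⁻¹) ^ a) (Icc 0 T ×ˢ univ) := fun a =>
      ((hcontω.norm.pow 2).add continuousOn_const).rpow_const fun z _ =>
        Or.inl (add_pos_of_nonneg_of_pos (sq_nonneg _) hj).ne'
    have hflux : ContinuousOn (fun σ => ∫ x, fderiv ℝ (cutoff R) x (v σ x) *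
        (Θ σ x ^ 2 * (‖curl (v σ) x‖ ^ 2 + ((j : ℝ) + 1)⁻¹) ^ (q / 2))) (Icc 0 T) := by
      have h' : ContinuousOn (fun σ => ∫ x, cutoff (2 * R) x * (fderiv ℝ (cutoff R) x (v σ x) *
          (Θ σ x ^ 2 * (‖curl (v σ) x‖ ^ 2 + ((j : ℝ) + 1)⁻¹) ^ (q / 2)))) (Icc 0 T) :=
        continuousOn_integral_mul_of_continuousOn (G := fun z : ℝ × (EuclideanSpace ℝ (Fin 3)) =>
            fderiv ℝ (cutoff R) z.2 (v z.1 z.2) *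
              (Θ z.1 z.2 ^ 2 * (‖curl (v z.1) z.2‖ ^ 2 + ((j : ℝ) + 1)⁻¹) ^ (q / 2)))
          hχ2 hχ2c
          ((((hχ1.continuous_fderiv one_ne_zero).comp continuous_snd).continuousOn.clm_apply hcontv).mul
            ((hcontΘ.pow 2).mul (hPc _)))
      refine h'.congr fun σ _ => ?_
      rw [hflux_eq σ]
      exact integral_congr_ae (Eventually.of_forall fun x => by simp only; ring)
    have hsrc : ContinuousOn (fun σ => ∫ x, cutoff R x *
        (q / 2 * Θ σ x ^ 2 * (‖curl (v σ) x‖ ^ 2 + ((j : ℝ) + 1)⁻¹) ^ (q / 2 - 1) *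
            ⟪curl (v σ) x, fderiv ℝ (v σ) x (curl (v σ) x)⟫ +
          Θ σ x * (‖curl (v σ) x‖ ^ 2 + ((j : ℝ) + 1)⁻¹) ^ (q / 2) *
            (FluidPDE.timeDerivWithin (Icc 0 T) Θ σ x + fderiv ℝ (Θ σ) x (v σ x)))) (Icc 0 T) :=
      continuousOn_integral_mul_of_continuousOn (G := fun z : ℝ × (EuclideanSpace ℝ (Fin 3)) =>
          q / 2 * Θ z.1 z.2 ^ 2 * (‖curl (v z.1) z.2‖ ^ 2 + ((j : ℝ) + 1)⁻¹) ^ (q / 2 - 1) *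
              ⟪curl (v z.1) z.2, fderiv ℝ (v z.1) z.2 (curl (v z.1) z.2)⟫ +
            Θ z.1 z.2 * (‖curl (v z.1) z.2‖ ^ 2 + ((j : ℝ) + 1)⁻¹) ^ (q / 2) *
              (FluidPDE.timeDerivWithin (Icc 0 T) Θ z.1 z.2 + fderiv ℝ (Θ z.1) z.2 (v z.1 z.2)))
        hχ hχc
        ((((continuousOn_const.mul (hcontΘ.pow 2)).mul (hPc _)).mul
          (hcontω.inner (hcontA.clm_apply hcontω))).add ((hcontΘ.mul (hPc _)).mul hcontm))
    have hsum := (hflux.const_smul (2⁻¹ : ℝ)).add hsrc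
    refine hsum.congr fun σ _ => ?_
    simp only [hG, Pi.add_apply, Pi.smul_apply, smul_eq_mul]
  -- dominated convergence in `σ`
  have hRlim : Tendsto (fun j : ℕ => ∫ σ in Ioo 0 T, G j σ) atTop
      (𝓝 (∫ σ in Ioo 0 T, (2⁻¹ * (∫ x, fderiv ℝ (cutoff R) x (v σ x) * (Θ σ x ^ 2 * ‖curl (v σ) x‖ ^ q)) +
        ((∫ x, cutoff R x * (q / 2 * Θ σ x ^ 2) * (‖curl (v σ) x‖ ^ q *
            ⟪‖curl (v σ) x‖⁻¹ • curl (v σ) x, fderiv ℝ (v σ) x (‖curl (v σ) x‖⁻¹ • curl (v σ) x)⟫)) +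
          ∫ x, cutoff R x * (Θ σ x *
              (FluidPDE.timeDerivWithin (Icc 0 T) Θ σ x + fderiv ℝ (Θ σ) x (v σ x))) *
            ‖curl (v σ) x‖ ^ q)))) := by
    refine tendsto_integral_of_dominated_convergence (fun _ => K) ?_ ?_ ?_ ?_
    · intro j
      exact ((hGcont j).mono Ioo_subset_Icc_self).aestronglyMeasurable measurableSet_Ioo
    · exact integrableOn_const (by simp)
    · intro j
      rw [ae_restrict_iff' measurableSet_Ioo]
      exact Eventually.of_forall fun σ hσ => hGbound j σ hσ
    · rw [ae_restrict_iff' measurableSet_Ioo]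
      exact Eventually.of_forall fun σ hσ => hGlim σ hσ
  -- conclude by uniqueness of limits
  have heq : (fun j : ℕ =>
      2⁻¹ * (∫ x, cutoff R x * (Θ T x ^ 2 * (‖curl (v T) x‖ ^ 2 + ((j : ℝ) + 1)⁻¹) ^ (q / 2))) -
        2⁻¹ * (∫ x, cutoff R x * (Θ 0 x ^ 2 * (‖curl (v 0) x‖ ^ 2 + ((j : ℝ) + 1)⁻¹) ^ (q / 2)))) =
      fun j => ∫ σ in Ioo 0 T, G j σ := funext fun j => by rw [hid j]
  rw [heq] at hL
  exact tendsto_nhds_unique hL hRlim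

end Eps

end Summit.NavierStokesRegularity.NavierStokesRegularity.Theorems.PowerGaugeEulerLiouville.VorticityDecay

end
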